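import Summits.CriticalPhenomena.Ising3DConformalLimit.Theses.ReflectionTwin
import Summits.CriticalPhenomena.Ising3DConformalLimit.Theorems.TwinTransparency.Negative.WithoutOrderThreshold
import Literature.Probability.LatticeModels.TwistCorrBoxLimit
import HarnessLib

/-!
# Audit and exact reductions for stub `stub_replicaMirrorMixedUniform` (S5b-u) of line `replica-mirror` (v4)
(crux `ReflectionTwin.TwinTransparency`, stmt-CriticalPhenomena-16905) — worker scratch, NOT a landing

S5b-u = the MIXED instance of the replica mirror: on configurations with at least one point strictly below and one
strictly above the plane `x₀+x₁+x₂ = 0`, `ρ(δ)^k · replicaFold δ k w → S k w` locally uniformly, where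
`replicaFold δ k w = limsup_L replicaBox L k (h w ≤ 0) [fold w/δ]` and
`replicaBox L k old z = ⟨(∏_{old i} σ_{zᵢ}) · E_L[∏_{¬old i} σ'_{zᵢ} | spins off {h ≤ -1}]⟩^∅_{box 3 L; β_c(3)}`.

Kernel-checked content of this file (no new hypotheses; the only `sorry`s are the two `_OPEN` statements of §4):

* §1 the objects of the registered signature as NAMED closed terms (`replicaBoxA`, `replicaFoldA`, `condLowA`, …;
  bodies verbatim, bridges by `rfl`);
* §2 general finite-volume facts about the exact conditional resampling `E_c[· | σ_a, q a]` of a pair-interaction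
  Ising measure: bounded by `1` on functions bounded by `1`; the tower property; the SELF-ADJOINT / MARKOV
  FACTORISATION `⟨f · E[g|𝓕]⟩ = ⟨E[f|𝓕] · E[g|𝓕]⟩`; covariance under the global flip `s ↦ -s`;
* §2 (cont.) the MARKOV PROPERTY across a cut (`condExp_markov`: if no coupling joins a resampled site to a frozen
  site off the layer `B`, the conditional expectation of a function of the resampled spins depends on the frozen
  data only through `B` — re-gluing bijection between classes, weights change by a common factor `gibbsWeight_glue`);
* §3 consequences for the replica objects: `|replicaBox| ≤ 1`, `|replicaFold| ≤ 1` (so the `limsup` is a genuine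
  number of `[-1, 1]`); `replicaBox L k old z = 0` for ODD `k` and every `old`, hence `replicaFold δ k w = 0` for odd
  `k` (the stub's restriction to even `k` is exactly where the content is); the factorisation
  `replicaBox L k old z = ⟨m_old · m_new⟩^∅_{box L}` with `m_old = E_L[∏_{old} σ_z | spins off {h ≤ -1}]`,
  `m_new = E_L[∏_{new} σ_z | spins off {h ≤ -1}]` (both lower-half-crystal RESPONSES of the same boundary data);
  the Markov property of both responses for the free n.n. box (`condLowA_{old,new}ProdA_markov`: functions of the
  plane layer `σ_P`, `P = {h = 0}`, once the sites are in `{h ≤ -1}`); the fold geometry (`height_thetaA`: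
  `h(θv) = -h(v)`; `height_fold_site_le`: for `δ > 0` and `h(v) ≠ 0` the site `[fold v/δ]` is in `{h ≤ -1}`); and
  the summary `replicaFoldA_structure`: on the stub's set, for `δ > 0`,
  `replicaFold δ k w = limsup_L ⟨m_old(σ_P) · m_new(σ_P)⟩^∅_{box L; β_c}` with both responses Markov;
* §4 the open content, stated exactly: `responsePairing_OPEN` (the stub with `replicaBox` replaced by the symmetric
  pairing `⟨m_old m_new⟩`), its first instance `responsePairing_two_OPEN` (`k = 2`, one point on each side), and the
  sorry-free reduction `stub_replicaMirrorMixedUniform_of_responsePairing` (registered signature verbatim ← §4.1).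

What is MISSING (no decl in tree or Literature; no proof in print): the asymptotic invariance of the response
pairing `E_L[m_X(σ_P) m_Z(σ_P)]` of the critical (111) half-crystal under the in-plane half-turn `R` — equivalently
`lim ρ(δ)^k E_L[m_{[X/δ]} m_{[θY/δ]}] = S_k(X ∪ Y)` — i.e. RG-irrelevance of the `R`-odd part of the half-space
boundary response ("Markov-decomposition universality": in the continuum it is `θ`-symmetry + the domain Markov
property of the limit CFT; on the lattice `θ` is not a symmetry of `ℤ³` and `R = -θ` is not a symmetry of the
half-crystal, so there is no finite-volume identity and no correlation-inequality route).
-/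

noncomputable section

namespace Summit.CriticalPhenomena.Ising3DConformalLimit.Cruxes.TwinTransparency.ReplicaMirror.S5bAudit

open scoped BigOperators Topology Manifold Classical MeasureTheory ProbabilityTheory Matrix InnerProductSpace ComplexConjugate ContinuousMap
open Filter Set Function TopologicalSpace MeasureTheory
open Literature.Probability.LatticeModels
open Summit.CriticalPhenomena.Ising3DConformalLimit.Theorems.TwinTransparency.Negative (gibbsAvg_eq_zero_of_flipOn spinAt_flipOn)

/-! ## §1 The objects of the registered signature as named closed terms -/

/-- The Euclidean reflection `θ` in the plane `x₀+x₁+x₂ = 0` (verbatim sub-term). [folklore] -/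
def thetaA : EuclideanSpace ℝ (Fin 3) → EuclideanSpace ℝ (Fin 3) :=
  (fun v : EuclideanSpace ℝ (Fin 3) => ((ℝ ∙ (EuclideanSpace.single 0 1 + EuclideanSpace.single 1 1 + EuclideanSpace.single 2 1 : EuclideanSpace ℝ (Fin 3)))ᗮ).reflection v)

/-- The fold `v ↦ v` below the plane, `θ v` above (verbatim sub-term). [folklore] -/
def foldA : EuclideanSpace ℝ (Fin 3) → EuclideanSpace ℝ (Fin 3) :=
  (fun v : EuclideanSpace ℝ (Fin 3) => if v 0 + v 1 + v 2 ≤ 0 then v else (fun v : EuclideanSpace ℝ (Fin 3) => ((ℝ ∙ (EuclideanSpace.single 0 1 + EuclideanSpace.single 1 1 + EuclideanSpace.single 2 1 : EuclideanSpace ℝ (Fin 3)))ᗮ).reflection v) v)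

/-- The free-box nearest-neighbour critical couplings (verbatim sub-term). [folklore] -/
def nnA (L : ℕ) : ↥(box 3 L) → ↥(box 3 L) → ℝ :=
  (fun a b : ↥(box 3 L) => if (∑ i, |a.1 i - b.1 i| = 1) then criticalBeta 3 / 2 else (0:ℝ))

/-- The exact conditional resampling of the lower half-crystal `{h ≤ -1}` given the rest (verbatim sub-term). [folklore] -/
def condLowA (L : ℕ) : (SpinConfig ↥(box 3 L) → ℝ) → SpinConfig ↥(box 3 L) → ℝ :=
  (fun (g : SpinConfig ↥(box 3 L) → ℝ) (s : SpinConfig ↥(box 3 L)) => (∑ s' ∈ Finset.univ.filter (fun s' : SpinConfig ↥(box 3 L) => ∀ a : ↥(box 3 L), ¬ (a.1 0 + a.1 1 + a.1 2 ≤ -1) → s' a = s a), g s' * PairIsing.gibbsWeight (fun a b : ↥(box 3 L) => if (∑ i, |a.1 i - b.1 i| = 1) then criticalBeta 3 / 2 else (0:ℝ)) s') / (∑ s' ∈ Finset.univ.filter (fun s' : SpinConfig ↥(box 3 L) => ∀ a : ↥(box 3 L), ¬ (a.1 0 + a.1 1 + a.1 2 ≤ -1) → s' a = s a), PairIsing.gibbsWeight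 (fun a b : ↥(box 3 L) => if (∑ i, |a.1 i - b.1 i| = 1) then criticalBeta 3 / 2 else (0:ℝ)) s'))

/-- The OLD monomial `∏_{old i} σ_{zᵢ}` (junk factor `0` off the box). [folklore] -/
def oldProdA (L k : ℕ) (old : Fin k → Prop) (z : Fin k → Site 3) (s : SpinConfig ↥(box 3 L)) : ℝ :=
  ∏ i, if old i then (if h : z i ∈ box 3 L then spinAt (⟨z i, h⟩ : ↥(box 3 L)) s else 0) else 1

/-- The NEW monomial `∏_{¬ old i} σ_{zᵢ}` (junk factor `0` off the box). [folklore] -/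
def newProdA (L k : ℕ) (old : Fin k → Prop) (z : Fin k → Site 3) (s' : SpinConfig ↥(box 3 L)) : ℝ :=
  ∏ i, if old i then 1 else (if h : z i ∈ box 3 L then spinAt (⟨z i, h⟩ : ↥(box 3 L)) s' else 0)

/-- `replicaBox` (verbatim sub-term of the registered signature). [folklore] -/
def replicaBoxA : (L k : ℕ) → (Fin k → Prop) → (Fin k → Site 3) → ℝ :=
  (fun (L k : ℕ) (old : Fin k → Prop) (z : Fin k → Site 3) => PairIsing.gibbsAvg (fun a b : ↥(box 3 L) => if (∑ i, |a.1 i - b.1 i| = 1) then criticalBeta 3 / 2 else (0:ℝ)) (fun s => (∏ i, if old i then (if h : z i ∈ box 3 L then spinAt (⟨z i, h⟩ : ↥(box 3 L)) s else 0) else 1) * (fun (g : SpinConfig ↥(box 3 L) → ℝ) (s : SpinConfig ↥(box 3 L)) => (∑ s' ∈ Finset.univ.filter (fun s' : SpinConfig ↥(box 3 L) => ∀ a : ↥(box 3 L), ¬ (a.1 0 + a.1 1 + a.1 2 ≤ -1) → s' a = s a), g s' * PairIsing.gibbsWeight (fun a b : ↥(box 3 L) => if (∑ i, |a.1 i - b.1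 i| = 1) then criticalBeta 3 / 2 else (0:ℝ)) s') / (∑ s' ∈ Finset.univ.filter (fun s' : SpinConfig ↥(box 3 L) => ∀ a : ↥(box 3 L), ¬ (a.1 0 + a.1 1 + a.1 2 ≤ -1) → s' a = s a), PairIsing.gibbsWeight (fun a b : ↥(box 3 L) => if (∑ i, |a.1 i - b.1 i| = 1) then criticalBeta 3 / 2 else (0:ℝ)) s')) (fun s' => ∏ i, if old i then 1 else (if h : z i ∈ box 3 L then spinAt (⟨z i, h⟩ : ↥(box 3 L)) s' else 0)) s))

/-- `replicaFold` (the closed term the registered signature is applied to, verbatim). [folklore] -/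
def replicaFoldA : ℝ → (k : ℕ) → (Fin k → EuclideanSpace ℝ (Fin 3)) → ℝ :=
  (fun (δ : ℝ) (k : ℕ) (w : Fin k → EuclideanSpace ℝ (Fin 3)) => Filter.limsup (fun L : ℕ => (fun (L k : ℕ) (old : Fin k → Prop) (z : Fin k → Site 3) => PairIsing.gibbsAvg (fun a b : ↥(box 3 L) => if (∑ i, |a.1 i - b.1 i| = 1) then criticalBeta 3 / 2 else (0:ℝ)) (fun s => (∏ i, if old i then (if h : z i ∈ box 3 L then spinAt (⟨z i, h⟩ : ↥(box 3 L)) s else 0) else 1) * (fun (g : SpinConfig ↥(box 3 L) → ℝ) (s : SpinConfig ↥(box 3 L)) => (∑ s' ∈ Finset.univ.filter (fun s' : SpinConfig ↥(box 3 L) => ∀ a : ↥(box 3 L), ¬ (a.1 0 + a.1 1 + a.1 2 ≤ -1) → s' a = s a), g s' * PairIsing.gibbsWeight (fun a b : ↥(box 3 L) => if (∑ i, |a.1 i - b.1 i| = 1) then criticalBeta 3 / 2 else (0:ℝ)) s') / (∑ s' ∈ Finset.univ.filter (fun s' : SpinConfig ↥(box 3 L) => ∀ a : ↥(box 3 L),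 ¬ (a.1 0 + a.1 1 + a.1 2 ≤ -1) → s' a = s a), PairIsing.gibbsWeight (fun a b : ↥(box 3 L) => if (∑ i, |a.1 i - b.1 i| = 1) then criticalBeta 3 / 2 else (0:ℝ)) s')) (fun s' => ∏ i, if old i then 1 else (if h : z i ∈ box 3 L then spinAt (⟨z i, h⟩ : ↥(box 3 L)) s' else 0)) s)) L k (fun i => w i 0 + w i 1 + w i 2 ≤ 0) (fun i => latticeApprox δ ((fun v : EuclideanSpace ℝ (Fin 3) => if v 0 + v 1 + v 2 ≤ 0 then v else (fun v : EuclideanSpace ℝ (Fin 3) => ((ℝ ∙ (EuclideanSpace.single 0 1 + EuclideanSpace.single 1 1 + EuclideanSpace.single 2 1 : EuclideanSpace ℝ (Fin 3)))ᗮ).reflection v) v) (w i)))) Filter.atTop)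

/-- Bridge: `replicaBox = ⟨oldProd · condLow newProd⟩` over the named terms (`rfl`). [folklore] -/
theorem replicaBoxA_eq (L k : ℕ) (old : Fin k → Prop) (z : Fin k → Site 3) :
    replicaBoxA L k old z =
      PairIsing.gibbsAvg (nnA L) (fun s => oldProdA L k old z s * condLowA L (newProdA L k old z) s) := rfl

/-- Bridge: `replicaFold δ k w = limsup_L replicaBox L k (h w ≤ 0) [fold w/δ]` (`rfl`). [folklore] -/
theorem replicaFoldA_eq (δ : ℝ) (k : ℕ) (w : Fin k → EuclideanSpace ℝ (Fin 3)) :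
    replicaFoldA δ k w = Filter.limsup (fun L : ℕ =>
      replicaBoxA L k (fun i => w i 0 + w i 1 + w i 2 ≤ 0) (fun i => latticeApprox δ (foldA (w i)))) atTop := rfl

/-- Bridge: `condLowA` is the exact conditional expectation given the spins off `{h ≤ -1}` (`rfl`). [folklore] -/
theorem condLowA_eq (L : ℕ) (g : SpinConfig ↥(box 3 L) → ℝ) (s : SpinConfig ↥(box 3 L)) :
    condLowA L g s =
      (∑ s' ∈ Finset.univ.filter (fun s' : SpinConfig ↥(box 3 L) => ∀ a : ↥(box 3 L), ¬ (a.1 0 + a.1 1 + a.1 2 ≤ -1) → s' a = s a),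
          g s' * PairIsing.gibbsWeight (nnA L) s') /
        (∑ s' ∈ Finset.univ.filter (fun s' : SpinConfig ↥(box 3 L) => ∀ a : ↥(box 3 L), ¬ (a.1 0 + a.1 1 + a.1 2 ≤ -1) → s' a = s a),
          PairIsing.gibbsWeight (nnA L) s') := rfl

/-! ## §2 General finite-volume facts about the exact conditional resampling `E_c[· | σ_a, q a]` -/

section General

variable {ι : Type*} [Fintype ι] [DecidableEq ι]

/-- A weighted average over a non-empty class of a function bounded by `1` is bounded by `1`. [folklore] -/
theorem abs_classAvg_le_one {Ω : Type*} (C : Finset Ω) (hC : C.Nonempty) (wt g : Ω → ℝ)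
    (hwt : ∀ s, 0 < wt s) (hg : ∀ s, |g s| ≤ 1) :
    |(∑ s' ∈ C, g s' * wt s') / (∑ s' ∈ C, wt s')| ≤ 1 := by
  have hden : 0 < ∑ s' ∈ C, wt s' := Finset.sum_pos (fun s _ => hwt s) hC
  rw [abs_div, abs_of_pos hden, div_le_one hden]
  refine (Finset.abs_sum_le_sum_abs _ _).trans (Finset.sum_le_sum fun s _ => ?_)
  rw [abs_mul, abs_of_pos (hwt s)]
  exact mul_le_of_le_one_left (hwt s).le (hg s)

/-- `|⟨f⟩_c| ≤ 1` for `|f| ≤ 1`. [folklore] -/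
theorem abs_gibbsAvg_le_one (c : ι → ι → ℝ) {f : SpinConfig ι → ℝ} (hf : ∀ s, |f s| ≤ 1) :
    |PairIsing.gibbsAvg c f| ≤ 1 :=
  (PairIsing.abs_gibbsAvg_le c f).trans
    ((PairIsing.gibbsAvg_mono c (g := fun _ => 1) hf).trans_eq (PairIsing.gibbsAvg_const c 1))

/-- The exact conditional expectation `E_c[g | σ_a, q a](s)` of a function bounded by `1` is bounded by `1`
(the class of `s` contains `s`). [folklore] -/
theorem abs_condExp_le_one (c : ι → ι → ℝ) (q : ι → Prop) (g : SpinConfig ι → ℝ) (hg : ∀ s, |g s| ≤ 1)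
    {_ : ∀ s : SpinConfig ι, DecidablePred fun s' : SpinConfig ι => ∀ a, q a → s' a = s a} (s : SpinConfig ι) :
    |(∑ s' ∈ Finset.univ.filter (fun s' : SpinConfig ι => ∀ a, q a → s' a = s a), g s' * PairIsing.gibbsWeight c s') /
        (∑ s' ∈ Finset.univ.filter (fun s' : SpinConfig ι => ∀ a, q a → s' a = s a), PairIsing.gibbsWeight c s')| ≤ 1 :=
  abs_classAvg_le_one _ ⟨s, Finset.mem_filter.2 ⟨Finset.mem_univ _, fun _ _ => rfl⟩⟩ _ g
    (PairIsing.gibbsWeight_pos c) hg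

/-- **Class averages integrate to the full sum** (copy of the private helper of the landed S5au file). If
`C : Ω → Finset Ω` assigns to each point a class containing it, constant along each class, then for positive
weights the weighted sum of the class averages is the weighted sum. [folklore] -/
theorem sum_classAvg_mul_eq {Ω : Type*} [Fintype Ω] (C : Ω → Finset Ω) (hrefl : ∀ s, s ∈ C s)
    (hcls : ∀ s, ∀ s' ∈ C s, C s' = C s) (wt g : Ω → ℝ) (hwt : ∀ s, 0 < wt s) :
    ∑ s, (∑ s' ∈ C s, g s' * wt s') / (∑ s' ∈ C s, wt s') * wt s = ∑ s, g s * wt s := by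
  have hsymm : ∀ s s', s' ∈ C s ↔ s ∈ C s' := fun s s' =>
    ⟨fun h => by rw [hcls s s' h]; exact hrefl s, fun h => by rw [hcls s' s h]; exact hrefl s'⟩
  calc ∑ s, (∑ s' ∈ C s, g s' * wt s') / (∑ s' ∈ C s, wt s') * wt s
      = ∑ s, ∑ s' ∈ C s, g s' * wt s' * wt s / ∑ t ∈ C s', wt t := by
        refine Finset.sum_congr rfl fun s _ => ?_
        rw [div_mul_eq_mul_div, Finset.sum_mul, Finset.sum_div]
        exact Finset.sum_congr rfl fun s' hs' => by rw [hcls s s' hs']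
    _ = ∑ s', ∑ s ∈ C s', g s' * wt s' * wt s / ∑ t ∈ C s', wt t :=
        Finset.sum_comm' fun s s' =>
          ⟨fun h => ⟨(hsymm s s').1 h.2, Finset.mem_univ _⟩, fun h => ⟨Finset.mem_univ _, (hsymm s s').2 h.1⟩⟩
    _ = ∑ s', g s' * wt s' := by
        refine Finset.sum_congr rfl fun s' _ => ?_
        rw [← Finset.sum_div, ← Finset.mul_sum, mul_div_assoc,
          div_self (Finset.sum_pos (fun t _ => hwt t) ⟨s', hrefl s'⟩).ne', mul_one]

/-- The class `{s' | ∀ a, q a → s' a = s a}` of `s` is the class of each of its members. [folklore] -/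
theorem condClass_eq_of_mem (q : ι → Prop)
    {_ : ∀ s : SpinConfig ι, DecidablePred fun s' : SpinConfig ι => ∀ a, q a → s' a = s a} (s s' : SpinConfig ι)
    (hs' : s' ∈ Finset.univ.filter (fun s' : SpinConfig ι => ∀ a, q a → s' a = s a)) :
    Finset.univ.filter (fun t : SpinConfig ι => ∀ a, q a → t a = s' a) =
      Finset.univ.filter (fun t : SpinConfig ι => ∀ a, q a → t a = s a) :=
  Finset.filter_congr fun t _ => forall₂_congr fun a ha => by rw [(Finset.mem_filter.1 hs').2 a ha]

/-- **Tower property of the exact conditional resampling** (copy of the private helper of the landed S5au file):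
`⟨E_c[g | σ_a, q a]⟩_c = ⟨g⟩_c`. [folklore] -/
theorem gibbsAvg_condExp_eq (c : ι → ι → ℝ) (q : ι → Prop) (g : SpinConfig ι → ℝ)
    {_ : ∀ s : SpinConfig ι, DecidablePred fun s' : SpinConfig ι => ∀ a, q a → s' a = s a} :
    PairIsing.gibbsAvg c (fun s =>
        (∑ s' ∈ Finset.univ.filter (fun s' : SpinConfig ι => ∀ a, q a → s' a = s a),
            g s' * PairIsing.gibbsWeight c s') /
          (∑ s' ∈ Finset.univ.filter (fun s' : SpinConfig ι => ∀ a, q a → s' a = s a),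
            PairIsing.gibbsWeight c s')) =
      PairIsing.gibbsAvg c g := by
  rw [PairIsing.gibbsAvg_def, PairIsing.gibbsAvg_def]
  congr 1
  exact sum_classAvg_mul_eq (fun s => Finset.univ.filter fun s' : SpinConfig ι => ∀ a, q a → s' a = s a)
    (fun s => Finset.mem_filter.2 ⟨Finset.mem_univ _, fun _ _ => rfl⟩) (fun s s' hs' => condClass_eq_of_mem q s s' hs')
    _ g (PairIsing.gibbsWeight_pos c)

/-- **Pull-out property**: a conditional expectation is constant on classes, so
`E[f · E[g|𝓕] | 𝓕](s) = E[f|𝓕](s) · E[g|𝓕](s)`. [folklore] -/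
theorem condExp_mul_condExp (c : ι → ι → ℝ) (q : ι → Prop) (f g : SpinConfig ι → ℝ)
    {_ : ∀ s : SpinConfig ι, DecidablePred fun s' : SpinConfig ι => ∀ a, q a → s' a = s a} (s : SpinConfig ι) :
    (∑ s' ∈ Finset.univ.filter (fun s' : SpinConfig ι => ∀ a, q a → s' a = s a),
        (f s' * ((∑ t ∈ Finset.univ.filter (fun t : SpinConfig ι => ∀ a, q a → t a = s' a),
            g t * PairIsing.gibbsWeight c t) /
          (∑ t ∈ Finset.univ.filter (fun t : SpinConfig ι => ∀ a, q a → t a = s' a), PairIsing.gibbsWeight c t))) *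
          PairIsing.gibbsWeight c s') /
      (∑ s' ∈ Finset.univ.filter (fun s' : SpinConfig ι => ∀ a, q a → s' a = s a), PairIsing.gibbsWeight c s') =
    (∑ s' ∈ Finset.univ.filter (fun s' : SpinConfig ι => ∀ a, q a → s' a = s a), f s' * PairIsing.gibbsWeight c s') /
        (∑ s' ∈ Finset.univ.filter (fun s' : SpinConfig ι => ∀ a, q a → s' a = s a), PairIsing.gibbsWeight c s') *
      ((∑ s' ∈ Finset.univ.filter (fun s' : SpinConfig ι => ∀ a, q a → s' a = s a), g s' * PairIsing.gibbsWeight c s') /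
        (∑ s' ∈ Finset.univ.filter (fun s' : SpinConfig ι => ∀ a, q a → s' a = s a), PairIsing.gibbsWeight c s')) := by
  rw [div_mul_eq_mul_div, Finset.sum_mul]
  congr 1
  refine Finset.sum_congr rfl fun s' hs' => ?_
  rw [condClass_eq_of_mem q s s' hs']
  ring

/-- **Self-adjointness / Markov factorisation of the replica pairing**: `⟨f · E[g|𝓕]⟩_c = ⟨E[f|𝓕] · E[g|𝓕]⟩_c`
(tower property applied to `f · E[g|𝓕]`, then pull-out). [folklore] -/
theorem gibbsAvg_mul_condExp_eq (c : ι → ι → ℝ) (q : ι → Prop) (f g : SpinConfig ι → ℝ)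
    {_ : ∀ s : SpinConfig ι, DecidablePred fun s' : SpinConfig ι => ∀ a, q a → s' a = s a} :
    PairIsing.gibbsAvg c (fun s => f s *
        ((∑ s' ∈ Finset.univ.filter (fun s' : SpinConfig ι => ∀ a, q a → s' a = s a), g s' * PairIsing.gibbsWeight c s') /
          (∑ s' ∈ Finset.univ.filter (fun s' : SpinConfig ι => ∀ a, q a → s' a = s a), PairIsing.gibbsWeight c s'))) =
      PairIsing.gibbsAvg c (fun s =>
        (∑ s' ∈ Finset.univ.filter (fun s' : SpinConfig ι => ∀ a, q a → s' a = s a), f s' * PairIsing.gibbsWeight c s') /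
            (∑ s' ∈ Finset.univ.filter (fun s' : SpinConfig ι => ∀ a, q a → s' a = s a), PairIsing.gibbsWeight c s') *
          ((∑ s' ∈ Finset.univ.filter (fun s' : SpinConfig ι => ∀ a, q a → s' a = s a), g s' * PairIsing.gibbsWeight c s') /
            (∑ s' ∈ Finset.univ.filter (fun s' : SpinConfig ι => ∀ a, q a → s' a = s a), PairIsing.gibbsWeight c s'))) := by
  rw [← gibbsAvg_condExp_eq c q (fun s => f s *
        ((∑ s' ∈ Finset.univ.filter (fun s' : SpinConfig ι => ∀ a, q a → s' a = s a), g s' * PairIsing.gibbsWeight c s') /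
          (∑ s' ∈ Finset.univ.filter (fun s' : SpinConfig ι => ∀ a, q a → s' a = s a), PairIsing.gibbsWeight c s')))]
  congr 1
  funext s
  exact condExp_mul_condExp c q f g s

omit [Fintype ι] [DecidableEq ι] in
/-- The real spin of the globally flipped configuration. [folklore] -/
theorem spinAt_neg' (s : SpinConfig ι) (a : ι) : spinAt a (-s) = -spinAt a s := by
  simp [spinAt, Units.val_neg]

omit [DecidableEq ι] in
/-- The pair Boltzmann weight is invariant under the global flip. [folklore] -/
theorem gibbsWeight_neg (c : ι → ι → ℝ) (s : SpinConfig ι) :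
    PairIsing.gibbsWeight c (-s) = PairIsing.gibbsWeight c s := by
  unfold PairIsing.gibbsWeight
  simp only [spinAt_neg', neg_mul_neg]

/-- **Flip covariance of the conditional resampling**: `E[g | 𝓕](-s) = E[g ∘ (-·) | 𝓕](s)` (re-index the class
of `-s` by the global flip, which preserves the weights). [folklore] -/
theorem condExp_neg (c : ι → ι → ℝ) (q : ι → Prop) (g : SpinConfig ι → ℝ)
    {_ : ∀ s : SpinConfig ι, DecidablePred fun s' : SpinConfig ι => ∀ a, q a → s' a = s a} (s : SpinConfig ι) :
    (∑ s' ∈ Finset.univ.filter (fun s' : SpinConfig ι => ∀ a, q a → s' a = (-s) a), g s' * PairIsing.gibbsWeight c s') /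
        (∑ s' ∈ Finset.univ.filter (fun s' : SpinConfig ι => ∀ a, q a → s' a = (-s) a), PairIsing.gibbsWeight c s') =
      (∑ s' ∈ Finset.univ.filter (fun s' : SpinConfig ι => ∀ a, q a → s' a = s a), g (-s') * PairIsing.gibbsWeight c s') /
        (∑ s' ∈ Finset.univ.filter (fun s' : SpinConfig ι => ∀ a, q a → s' a = s a), PairIsing.gibbsWeight c s') := by
  have hmem : ∀ t : SpinConfig ι,
      t ∈ Finset.univ.filter (fun s' : SpinConfig ι => ∀ a, q a → s' a = (-s) a) ↔
        (Equiv.neg (SpinConfig ι)) t ∈ Finset.univ.filter (fun s' : SpinConfig ι => ∀ a, q a → s' a = s a) := by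
    intro t
    simp only [Finset.mem_filter, Finset.mem_univ, true_and, Equiv.neg_apply, Pi.neg_apply, neg_eq_iff_eq_neg]
  rw [Finset.sum_equiv (Equiv.neg (SpinConfig ι)) (g := fun s' => g (-s') * PairIsing.gibbsWeight c s') hmem
      fun t _ => by simp only [Equiv.neg_apply, neg_neg, gibbsWeight_neg],
    Finset.sum_equiv (Equiv.neg (SpinConfig ι)) (g := fun s' => PairIsing.gibbsWeight c s') hmem
      fun t _ => by simp only [Equiv.neg_apply, gibbsWeight_neg]]

/-- Hence a function with flip parity `ε` has a conditional resampling with flip parity `ε`. [folklore] -/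
theorem condExp_neg_of_parity (c : ι → ι → ℝ) (q : ι → Prop) (g : SpinConfig ι → ℝ) (ε : ℝ)
    (hg : ∀ s, g (-s) = ε * g s)
    {_ : ∀ s : SpinConfig ι, DecidablePred fun s' : SpinConfig ι => ∀ a, q a → s' a = s a} (s : SpinConfig ι) :
    (∑ s' ∈ Finset.univ.filter (fun s' : SpinConfig ι => ∀ a, q a → s' a = (-s) a), g s' * PairIsing.gibbsWeight c s') /
        (∑ s' ∈ Finset.univ.filter (fun s' : SpinConfig ι => ∀ a, q a → s' a = (-s) a), PairIsing.gibbsWeight c s') =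
      ε * ((∑ s' ∈ Finset.univ.filter (fun s' : SpinConfig ι => ∀ a, q a → s' a = s a), g s' * PairIsing.gibbsWeight c s') /
        (∑ s' ∈ Finset.univ.filter (fun s' : SpinConfig ι => ∀ a, q a → s' a = s a), PairIsing.gibbsWeight c s')) := by
  rw [condExp_neg c q g s, mul_div_assoc', Finset.mul_sum]
  congr 1
  refine Finset.sum_congr rfl fun s' _ => ?_
  rw [hg, mul_assoc]

/-- Sign bookkeeping. [folklore] -/
private theorem parity_algebra {εf εg a b : ℝ} (hε : εf * εg = -1) : εf * a * (εg * b) = -(a * b) := by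
  linear_combination (a * b) * hε

/-- An observable ODD under the global flip `s ↦ -s` has Gibbs average zero (the flip preserves every pair
weight; cf. `gibbsAvg_eq_zero_of_flipOn` with the trivial cut). [folklore] -/
theorem gibbsAvg_eq_zero_of_neg (c : ι → ι → ℝ) (F : SpinConfig ι → ℝ) (hF : ∀ s, F (-s) = -F s) :
    PairIsing.gibbsAvg c F = 0 := by
  rw [PairIsing.gibbsAvg_def]
  have hnum : ∑ s, F s * PairIsing.gibbsWeight c s = 0 := by
    have h1 : ∑ s, F s * PairIsing.gibbsWeight c s = ∑ s, F (-s) * PairIsing.gibbsWeight c (-s) :=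
      (Equiv.sum_comp (Equiv.neg (SpinConfig ι)) (fun s => F s * PairIsing.gibbsWeight c s)).symm
    have h2 : ∑ s, F (-s) * PairIsing.gibbsWeight c (-s) = -∑ s, F s * PairIsing.gibbsWeight c s := by
      rw [← Finset.sum_neg_distrib]
      exact Finset.sum_congr rfl fun s _ => by rw [hF, gibbsWeight_neg, neg_mul]
    linarith
  rw [hnum, zero_div]

/-- **Odd replica pairings vanish**: if `f` and `g` have flip parities `εf`, `εg` with `εf εg = -1`, then
`⟨f · E[g|𝓕]⟩_c = 0`. [folklore] -/
theorem gibbsAvg_mul_condExp_eq_zero_of_parity (c : ι → ι → ℝ) (q : ι → Prop) (f g : SpinConfig ι → ℝ)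
    (εf εg : ℝ) (hf : ∀ s, f (-s) = εf * f s) (hg : ∀ s, g (-s) = εg * g s) (hε : εf * εg = -1)
    {_ : ∀ s : SpinConfig ι, DecidablePred fun s' : SpinConfig ι => ∀ a, q a → s' a = s a} :
    PairIsing.gibbsAvg c (fun s => f s *
        ((∑ s' ∈ Finset.univ.filter (fun s' : SpinConfig ι => ∀ a, q a → s' a = s a), g s' * PairIsing.gibbsWeight c s') /
          (∑ s' ∈ Finset.univ.filter (fun s' : SpinConfig ι => ∀ a, q a → s' a = s a), PairIsing.gibbsWeight c s'))) =
      0 := by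
  refine gibbsAvg_eq_zero_of_neg c _ fun s => ?_
  show f (-s) * _ = -(f s * _)
  rw [condExp_neg_of_parity c q g εg hg s, hf]
  exact parity_algebra hε

/-! ### Markov property of the exact conditional resampling across a cut -/

omit [Fintype ι] [DecidableEq ι] in
/-- Equal spins give equal real spins. [folklore] -/
theorem spinAt_congr' {s t : SpinConfig ι} {a : ι} (h : s a = t a) : spinAt a s = spinAt a t := by
  simp [spinAt, h]

/-- The interaction energy among the FROZEN sites `{¬ p}`: `D(s) = Σ_{¬p a, ¬p b} c_ab σ_a σ_b`. [folklore] -/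
def offEnergy (c : ι → ι → ℝ) (p : ι → Prop) [DecidablePred p] (s : SpinConfig ι) : ℝ :=
  ∑ a, ∑ b, if ¬ p a ∧ ¬ p b then c a b * (spinAt a s * spinAt b s) else 0

omit [DecidableEq ι] in
/-- **Gluing changes the weight by a boundary-independent factor.** If no coupling joins a resampled site
(`p a`) to a frozen site off the boundary layer `B`, then re-gluing the resampled part of `s'` (a member of the
class of `s`) onto frozen data `t` that agrees with `s` on `B` multiplies the Boltzmann weight by
`exp(D(t) - D(s))`, a factor independent of the resampled spins. [folklore] -/
theorem gibbsWeight_glue (c : ι → ι → ℝ) (p B : ι → Prop) [DecidablePred p]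
    (hc : ∀ a b, p a → ¬ p b → ¬ B b → c a b = 0 ∧ c b a = 0) (s t s' : SpinConfig ι)
    (hs' : ∀ a, ¬ p a → s' a = s a) (hB : ∀ a, B a → s a = t a) :
    PairIsing.gibbsWeight c (fun a => if p a then s' a else t a) =
      PairIsing.gibbsWeight c s' * Real.exp (offEnergy c p t - offEnergy c p s) := by
  unfold PairIsing.gibbsWeight offEnergy
  rw [← Real.exp_add]
  congr 1
  rw [← Finset.sum_sub_distrib, ← Finset.sum_add_distrib]
  refine Finset.sum_congr rfl fun a _ => ?_
  rw [← Finset.sum_sub_distrib, ← Finset.sum_add_distrib]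
  refine Finset.sum_congr rfl fun b _ => ?_
  have hglue : ∀ x, spinAt x (fun a => if p a then s' a else t a) = if p x then spinAt x s' else spinAt x t := by
    intro x
    by_cases hx : p x <;> simp [spinAt, hx]
  rw [hglue, hglue]
  by_cases ha : p a <;> by_cases hb : p b
  · simp [ha, hb]
  · simp only [ha, hb, if_true, if_false, not_true, false_and, sub_self, add_zero]
    by_cases hBb : B b
    · rw [spinAt_congr' (hs' b hb), spinAt_congr' (hB b hBb)]
    · rw [(hc a b ha hb hBb).1, zero_mul, zero_mul]
  · simp only [ha, hb, if_true, if_false, not_true, and_false, sub_self, add_zero]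
    by_cases hBa : B a
    · rw [spinAt_congr' (hs' a ha), spinAt_congr' (hB a hBa)]
    · rw [(hc b a hb ha hBa).2, zero_mul, zero_mul]
  · simp only [ha, hb, if_false, not_false_eq_true, and_self, if_true]
    rw [spinAt_congr' (hs' a ha), spinAt_congr' (hs' b hb)]
    ring

/-- **Markov property of the exact conditional resampling.** Under the same cut hypothesis, the conditional
expectation `E_c[g | σ_a, ¬ p a](s)` of a function `g` of the resampled spins depends on the frozen data `s` only
through its restriction to the boundary layer `B`: the class of `s₂` is the re-gluing of the class of `s₁`
(`Finset.sum_nbij'`), along which `g` is unchanged and the weights change by the common factor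
`exp(D(s₂) - D(s₁))` (`gibbsWeight_glue`), which cancels in the ratio. [folklore] -/
theorem condExp_markov (c : ι → ι → ℝ) (p B : ι → Prop) [DecidablePred p]
    (hc : ∀ a b, p a → ¬ p b → ¬ B b → c a b = 0 ∧ c b a = 0)
    (g : SpinConfig ι → ℝ) (hg : ∀ s s' : SpinConfig ι, (∀ a, p a → s a = s' a) → g s = g s')
    {_ : ∀ s : SpinConfig ι, DecidablePred fun s' : SpinConfig ι => ∀ a, ¬ p a → s' a = s a}
    (s₁ s₂ : SpinConfig ι) (hB : ∀ a, B a → s₁ a = s₂ a) :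
    (∑ s' ∈ Finset.univ.filter (fun s' : SpinConfig ι => ∀ a, ¬ p a → s' a = s₁ a), g s' * PairIsing.gibbsWeight c s') /
        (∑ s' ∈ Finset.univ.filter (fun s' : SpinConfig ι => ∀ a, ¬ p a → s' a = s₁ a), PairIsing.gibbsWeight c s') =
      (∑ s' ∈ Finset.univ.filter (fun s' : SpinConfig ι => ∀ a, ¬ p a → s' a = s₂ a), g s' * PairIsing.gibbsWeight c s') /
        (∑ s' ∈ Finset.univ.filter (fun s' : SpinConfig ι => ∀ a, ¬ p a → s' a = s₂ a), PairIsing.gibbsWeight c s') := by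
  -- the re-gluing maps between the two classes
  set Φ : SpinConfig ι → SpinConfig ι := fun s' a => if p a then s' a else s₂ a with hΦ
  set Ψ : SpinConfig ι → SpinConfig ι := fun s' a => if p a then s' a else s₁ a with hΨ
  have hΦmem : ∀ s' ∈ Finset.univ.filter (fun s' : SpinConfig ι => ∀ a, ¬ p a → s' a = s₁ a),
      Φ s' ∈ Finset.univ.filter (fun s' : SpinConfig ι => ∀ a, ¬ p a → s' a = s₂ a) := fun s' _ =>
    Finset.mem_filter.2 ⟨Finset.mem_univ _, fun a ha => by simp [hΦ, ha]⟩
  have hΨmem : ∀ s' ∈ Finset.univ.filter (fun s' : SpinConfig ι => ∀ a, ¬ p a → s' a = s₂ a),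
      Ψ s' ∈ Finset.univ.filter (fun s' : SpinConfig ι => ∀ a, ¬ p a → s' a = s₁ a) := fun s' _ =>
    Finset.mem_filter.2 ⟨Finset.mem_univ _, fun a ha => by simp [hΨ, ha]⟩
  have hΨΦ : ∀ s' ∈ Finset.univ.filter (fun s' : SpinConfig ι => ∀ a, ¬ p a → s' a = s₁ a), Ψ (Φ s') = s' := by
    intro s' hs'
    funext a
    by_cases ha : p a
    · simp [hΨ, hΦ, ha]
    · simp [hΨ, ha, (Finset.mem_filter.1 hs').2 a ha]
  have hΦΨ : ∀ s' ∈ Finset.univ.filter (fun s' : SpinConfig ι => ∀ a, ¬ p a → s' a = s₂ a), Φ (Ψ s') = s' := by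
    intro s' hs'
    funext a
    by_cases ha : p a
    · simp [hΨ, hΦ, ha]
    · simp [hΦ, ha, (Finset.mem_filter.1 hs').2 a ha]
  -- along the re-gluing the weights change by the common positive factor `K`
  have hw : ∀ s' ∈ Finset.univ.filter (fun s' : SpinConfig ι => ∀ a, ¬ p a → s' a = s₁ a),
      PairIsing.gibbsWeight c (Φ s') =
        PairIsing.gibbsWeight c s' * Real.exp (offEnergy c p s₂ - offEnergy c p s₁) := fun s' hs' =>
    gibbsWeight_glue c p B hc s₁ s₂ s' (Finset.mem_filter.1 hs').2 hB
  have hgΦ : ∀ s', g (Φ s') = g s' := fun s' => hg _ _ fun a ha => by simp [hΦ, ha]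
  have hnum : ∑ s' ∈ Finset.univ.filter (fun s' : SpinConfig ι => ∀ a, ¬ p a → s' a = s₂ a),
      g s' * PairIsing.gibbsWeight c s' =
      (∑ s' ∈ Finset.univ.filter (fun s' : SpinConfig ι => ∀ a, ¬ p a → s' a = s₁ a),
        g s' * PairIsing.gibbsWeight c s') * Real.exp (offEnergy c p s₂ - offEnergy c p s₁) := by
    rw [Finset.sum_mul]
    symm
    refine Finset.sum_nbij' Φ Ψ hΦmem hΨmem hΨΦ hΦΨ fun s' hs' => ?_
    rw [hgΦ, hw s' hs']
    ring
  have hden : ∑ s' ∈ Finset.univ.filter (fun s' : SpinConfig ι => ∀ a, ¬ p a → s' a = s₂ a),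
      PairIsing.gibbsWeight c s' =
      (∑ s' ∈ Finset.univ.filter (fun s' : SpinConfig ι => ∀ a, ¬ p a → s' a = s₁ a),
        PairIsing.gibbsWeight c s') * Real.exp (offEnergy c p s₂ - offEnergy c p s₁) := by
    rw [Finset.sum_mul]
    symm
    exact Finset.sum_nbij' Φ Ψ hΦmem hΨmem hΨΦ hΦΨ fun s' hs' => (hw s' hs').symm
  rw [hnum, hden, mul_div_mul_right _ _ (Real.exp_pos _).ne']

end General

/-! ## §3 Consequences for the replica objects -/

/-- `|oldProd| ≤ 1`. [folklore] -/
theorem abs_oldProdA_le_one (L k : ℕ) (old : Fin k → Prop) (z : Fin k → Site 3) (s : SpinConfig ↥(box 3 L)) :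
    |oldProdA L k old z s| ≤ 1 := by
  unfold oldProdA
  rw [Finset.abs_prod]
  refine Finset.prod_le_one (fun i _ => abs_nonneg _) fun i _ => ?_
  split_ifs <;> simp

/-- `|newProd| ≤ 1`. [folklore] -/
theorem abs_newProdA_le_one (L k : ℕ) (old : Fin k → Prop) (z : Fin k → Site 3) (s : SpinConfig ↥(box 3 L)) :
    |newProdA L k old z s| ≤ 1 := by
  unfold newProdA
  rw [Finset.abs_prod]
  refine Finset.prod_le_one (fun i _ => abs_nonneg _) fun i _ => ?_
  split_ifs <;> simp

/-- `|condLow g| ≤ 1` for `|g| ≤ 1`. [folklore] -/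
theorem abs_condLowA_le_one (L : ℕ) (g : SpinConfig ↥(box 3 L) → ℝ) (hg : ∀ s, |g s| ≤ 1)
    (s : SpinConfig ↥(box 3 L)) : |condLowA L g s| ≤ 1 :=
  abs_condExp_le_one (nnA L) _ g hg s

/-- **`|replicaBox L k old z| ≤ 1`** (an average of a product of two quantities bounded by `1`). [folklore] -/
theorem abs_replicaBoxA_le_one (L k : ℕ) (old : Fin k → Prop) (z : Fin k → Site 3) :
    |replicaBoxA L k old z| ≤ 1 := by
  rw [replicaBoxA_eq]
  refine abs_gibbsAvg_le_one _ fun s => ?_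
  rw [abs_mul]
  exact mul_le_one₀ (abs_oldProdA_le_one L k old z s) (abs_nonneg _)
    (abs_condLowA_le_one L _ (abs_newProdA_le_one L k old z) s)

/-- A `limsup` over `atTop : Filter ℕ` of a sequence with values in `[-1, 1]` lies in `[-1, 1]`. [folklore] -/
theorem abs_limsup_le_one {u : ℕ → ℝ} (hu : ∀ L, |u L| ≤ 1) : |Filter.limsup u atTop| ≤ 1 := by
  rw [abs_le]
  constructor
  · exact le_limsup_of_frequently_le (Eventually.of_forall fun L => (abs_le.1 (hu L)).1).frequently
      (isBoundedUnder_of ⟨1, fun L => (abs_le.1 (hu L)).2⟩)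
  · exact limsup_le_of_le (isCoboundedUnder_le_of_le atTop fun L => (abs_le.1 (hu L)).1)
      (Eventually.of_forall fun L => (abs_le.1 (hu L)).2)

/-- **`|replicaFold δ k w| ≤ 1`**: the `limsup` in the registered signature is a genuine number of `[-1, 1]`
(never the junk value of an unbounded `limsup`). [folklore] -/
theorem abs_replicaFoldA_le_one (δ : ℝ) (k : ℕ) (w : Fin k → EuclideanSpace ℝ (Fin 3)) :
    |replicaFoldA δ k w| ≤ 1 := by
  rw [replicaFoldA_eq]
  exact abs_limsup_le_one fun L => abs_replicaBoxA_le_one L k _ _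

/-- Flip parity of the OLD monomial: `(∏ old)(-s) = (∏_{old i} (-1)) · (∏ old)(s)` (junk factors included). [folklore] -/
theorem oldProdA_neg (L k : ℕ) (old : Fin k → Prop) (z : Fin k → Site 3) (s : SpinConfig ↥(box 3 L)) :
    oldProdA L k old z (-s) = (∏ i, if old i then (-1:ℝ) else 1) * oldProdA L k old z s := by
  unfold oldProdA
  rw [← Finset.prod_mul_distrib]
  refine Finset.prod_congr rfl fun i _ => ?_
  by_cases ho : old i
  · simp only [if_pos ho]
    by_cases h : z i ∈ box 3 L
    · rw [dif_pos h, dif_pos h, spinAt_neg', neg_one_mul]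
    · rw [dif_neg h, dif_neg h, mul_zero]
  · simp only [if_neg ho, one_mul]

/-- Flip parity of the NEW monomial. [folklore] -/
theorem newProdA_neg (L k : ℕ) (old : Fin k → Prop) (z : Fin k → Site 3) (s : SpinConfig ↥(box 3 L)) :
    newProdA L k old z (-s) = (∏ i, if old i then (1:ℝ) else -1) * newProdA L k old z s := by
  unfold newProdA
  rw [← Finset.prod_mul_distrib]
  refine Finset.prod_congr rfl fun i _ => ?_
  by_cases ho : old i
  · simp only [if_pos ho, one_mul]
  · simp only [if_neg ho]
    by_cases h : z i ∈ box 3 L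
    · rw [dif_pos h, dif_pos h, spinAt_neg', neg_one_mul]
    · rw [dif_neg h, dif_neg h, mul_zero]

/-- The two parities multiply to `(-1)^k`. [folklore] -/
theorem oldSign_mul_newSign {k : ℕ} (old : Fin k → Prop) :
    (∏ i, if old i then (-1:ℝ) else 1) * (∏ i, if old i then (1:ℝ) else -1) = (-1) ^ k := by
  rw [← Finset.prod_mul_distrib,
    Finset.prod_congr rfl fun i _ =>
      show (if old i then (-1:ℝ) else 1) * (if old i then (1:ℝ) else -1) = -1 by split_ifs <;> norm_num,
    Finset.prod_const, Finset.card_univ, Fintype.card_fin]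

/-- **Odd orders are trivial**: `replicaBox L k old z = 0` for ODD `k` and every `old`/`z` (total flip parity
`(-1)^k = -1`). So the registered restriction `Even k` is exactly where the content of S5b-u lies. [folklore] -/
theorem replicaBoxA_odd_eq_zero (L k : ℕ) (old : Fin k → Prop) (z : Fin k → Site 3) (hk : Odd k) :
    replicaBoxA L k old z = 0 := by
  rw [replicaBoxA_eq]
  exact gibbsAvg_mul_condExp_eq_zero_of_parity (nnA L) _ (oldProdA L k old z) (newProdA L k old z) _ _
    (oldProdA_neg L k old z) (newProdA_neg L k old z) (by rw [oldSign_mul_newSign, hk.neg_one_pow])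

/-- Hence `replicaFold δ k w = 0` at odd order. [folklore] -/
theorem replicaFoldA_odd_eq_zero (δ : ℝ) (k : ℕ) (w : Fin k → EuclideanSpace ℝ (Fin 3)) (hk : Odd k) :
    replicaFoldA δ k w = 0 := by
  rw [replicaFoldA_eq]
  simp only [replicaBoxA_odd_eq_zero _ k _ _ hk, limsup_const]

/-- **Markov / self-adjoint factorisation of the replica box pairing**:
`replicaBox L k old z = ⟨m_old · m_new⟩^∅_{box L; β_c}` with `m_old = E_L[∏_{old} σ_z | spins off {h ≤ -1}]` and
`m_new = E_L[∏_{new} σ_z | spins off {h ≤ -1}]` — the pairing of the two lower-half-crystal RESPONSES to the same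
boundary data, symmetric in old ↔ new. [folklore] -/
theorem replicaBoxA_eq_gibbsAvg_condLow_mul_condLow (L k : ℕ) (old : Fin k → Prop) (z : Fin k → Site 3) :
    replicaBoxA L k old z =
      PairIsing.gibbsAvg (nnA L) (fun s => condLowA L (oldProdA L k old z) s * condLowA L (newProdA L k old z) s) := by
  rw [replicaBoxA_eq]
  exact gibbsAvg_mul_condExp_eq (nnA L) _ (oldProdA L k old z) (newProdA L k old z)

/-- The same at `k = 2`, one OLD point `x` and one NEW point `y'` (both lower sites in the application):
`⟨σ_x · E_L[σ'_{y'} | 𝓕]⟩ = ⟨m_x · m_{y'}⟩` with `m_z = E_L[σ_z | spins off {h ≤ -1}]`. [folklore] -/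
theorem replicaBoxA_two_cross (L : ℕ) (x y' : Site 3) :
    replicaBoxA L 2 (fun i => (i : ℕ) = 0) ![x, y'] =
      PairIsing.gibbsAvg (nnA L) (fun s =>
        condLowA L (fun t => if h : x ∈ box 3 L then spinAt (⟨x, h⟩ : ↥(box 3 L)) t else 0) s *
          condLowA L (fun t => if h : y' ∈ box 3 L then spinAt (⟨y', h⟩ : ↥(box 3 L)) t else 0) s) := by
  rw [replicaBoxA_eq_gibbsAvg_condLow_mul_condLow]
  have hold : oldProdA L 2 (fun i => (i : ℕ) = 0) ![x, y'] =
      fun t => if h : x ∈ box 3 L then spinAt (⟨x, h⟩ : ↥(box 3 L)) t else 0 := by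
    funext t
    simp [oldProdA]
  have hnew : newProdA L 2 (fun i => (i : ℕ) = 0) ![x, y'] =
      fun t => if h : y' ∈ box 3 L then spinAt (⟨y', h⟩ : ↥(box 3 L)) t else 0 := by
    funext t
    simp [newProdA, Fin.prod_univ_two]
  rw [hold, hnew]

/-! ### The Markov property across the plane layer `P = {h = 0}` for the free n.n. box -/

/-- Nearest neighbours of `ℤ³` differ in height `h = z₀ + z₁ + z₂` by at most one. [folklore] -/
theorem abs_height_sub_le_one_of_nn {a b : Site 3} (h : ∑ i, |a i - b i| = 1) :
    |(a 0 + a 1 + a 2) - (b 0 + b 1 + b 2)| ≤ 1 := by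
  have hs : (a 0 + a 1 + a 2) - (b 0 + b 1 + b 2) = ∑ i, (a i - b i) := by
    simp only [Fin.sum_univ_three]
    ring
  rw [hs, ← h]
  exact Finset.abs_sum_le_sum_abs _ _

/-- **The cut hypothesis for the free n.n. box**: no coupling joins the resampled half-crystal `{h ≤ -1}` to a
frozen site off the plane layer `{h = 0}`. [folklore] -/
theorem nnA_cut (L : ℕ) : ∀ a b : ↥(box 3 L), a.1 0 + a.1 1 + a.1 2 ≤ -1 → ¬ (b.1 0 + b.1 1 + b.1 2 ≤ -1) →
    ¬ (b.1 0 + b.1 1 + b.1 2 = 0) → nnA L a b = 0 ∧ nnA L b a = 0 := by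
  intro a b ha hb hB
  have hfar : ¬ (∑ i, |a.1 i - b.1 i| = 1) := fun h => by
    have h1 := abs_height_sub_le_one_of_nn h
    rw [abs_le] at h1
    omega
  have hfar' : ¬ (∑ i, |b.1 i - a.1 i| = 1) := fun h => hfar (by simpa only [abs_sub_comm] using h)
  refine ⟨?_, ?_⟩
  · show (if (∑ i, |a.1 i - b.1 i| = 1) then criticalBeta 3 / 2 else (0:ℝ)) = 0
    rw [if_neg hfar]
  · show (if (∑ i, |b.1 i - a.1 i| = 1) then criticalBeta 3 / 2 else (0:ℝ)) = 0
    rw [if_neg hfar']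

/-- The OLD monomial is a function of the spins of `{h ≤ -1}` once every old site lies there. [folklore] -/
theorem oldProdA_congr_lower (L k : ℕ) (old : Fin k → Prop) (z : Fin k → Site 3)
    (hz : ∀ i, old i → z i 0 + z i 1 + z i 2 ≤ -1) (s s' : SpinConfig ↥(box 3 L))
    (hss' : ∀ a : ↥(box 3 L), a.1 0 + a.1 1 + a.1 2 ≤ -1 → s a = s' a) :
    oldProdA L k old z s = oldProdA L k old z s' := by
  unfold oldProdA
  refine Finset.prod_congr rfl fun i _ => ?_
  by_cases ho : old i
  · simp only [if_pos ho]
    by_cases h : z i ∈ box 3 L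
    · rw [dif_pos h, dif_pos h, spinAt_congr' (hss' ⟨z i, h⟩ (hz i ho))]
    · rw [dif_neg h, dif_neg h]
  · simp only [if_neg ho]

/-- The NEW monomial is a function of the spins of `{h ≤ -1}` once every new site lies there. [folklore] -/
theorem newProdA_congr_lower (L k : ℕ) (old : Fin k → Prop) (z : Fin k → Site 3)
    (hz : ∀ i, ¬ old i → z i 0 + z i 1 + z i 2 ≤ -1) (s s' : SpinConfig ↥(box 3 L))
    (hss' : ∀ a : ↥(box 3 L), a.1 0 + a.1 1 + a.1 2 ≤ -1 → s a = s' a) :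
    newProdA L k old z s = newProdA L k old z s' := by
  unfold newProdA
  refine Finset.prod_congr rfl fun i _ => ?_
  by_cases ho : old i
  · simp only [if_pos ho]
  · simp only [if_neg ho]
    by_cases h : z i ∈ box 3 L
    · rw [dif_pos h, dif_pos h, spinAt_congr' (hss' ⟨z i, h⟩ (hz i ho))]
    · rw [dif_neg h, dif_neg h]

/-- **Markov property of the lower-half-crystal response (old sites).** If every old site lies in `{h ≤ -1}`,
`m_old(s) = E_L[∏_{old} σ_z | spins off {h ≤ -1}](s)` depends on `s` only through the plane layer `{h = 0}`.
[folklore] -/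
theorem condLowA_oldProdA_markov (L k : ℕ) (old : Fin k → Prop) (z : Fin k → Site 3)
    (hz : ∀ i, old i → z i 0 + z i 1 + z i 2 ≤ -1) (s₁ s₂ : SpinConfig ↥(box 3 L))
    (hP : ∀ a : ↥(box 3 L), a.1 0 + a.1 1 + a.1 2 = 0 → s₁ a = s₂ a) :
    condLowA L (oldProdA L k old z) s₁ = condLowA L (oldProdA L k old z) s₂ :=
  condExp_markov (nnA L) (fun a : ↥(box 3 L) => a.1 0 + a.1 1 + a.1 2 ≤ -1)
    (fun a : ↥(box 3 L) => a.1 0 + a.1 1 + a.1 2 = 0) (nnA_cut L) _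
    (fun s s' h => oldProdA_congr_lower L k old z hz s s' h) s₁ s₂ hP

/-- **Markov property of the lower-half-crystal response (new sites).** [folklore] -/
theorem condLowA_newProdA_markov (L k : ℕ) (old : Fin k → Prop) (z : Fin k → Site 3)
    (hz : ∀ i, ¬ old i → z i 0 + z i 1 + z i 2 ≤ -1) (s₁ s₂ : SpinConfig ↥(box 3 L))
    (hP : ∀ a : ↥(box 3 L), a.1 0 + a.1 1 + a.1 2 = 0 → s₁ a = s₂ a) :
    condLowA L (newProdA L k old z) s₁ = condLowA L (newProdA L k old z) s₂ :=
  condExp_markov (nnA L) (fun a : ↥(box 3 L) => a.1 0 + a.1 1 + a.1 2 ≤ -1)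
    (fun a : ↥(box 3 L) => a.1 0 + a.1 1 + a.1 2 = 0) (nnA_cut L) _
    (fun s s' h => newProdA_congr_lower L k old z hz s s' h) s₁ s₂ hP

/-! ### Geometry of the fold: on the stub's set every site lies in the resampled half-crystal `{h ≤ -1}` -/

/-- The height is the inner product with the normal `n = e₀ + e₁ + e₂`. [folklore] -/
theorem height_eq_inner (u : EuclideanSpace ℝ (Fin 3)) :
    u 0 + u 1 + u 2 =
      ⟪(EuclideanSpace.single 0 1 + EuclideanSpace.single 1 1 + EuclideanSpace.single 2 1 : EuclideanSpace ℝ (Fin 3)), u⟫_ℝ := by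
  simp only [inner_add_left, EuclideanSpace.inner_single_left, map_one, one_mul]

/-- The normal is non-zero. [folklore] -/
theorem nvec_ne_zero :
    (EuclideanSpace.single 0 1 + EuclideanSpace.single 1 1 + EuclideanSpace.single 2 1 : EuclideanSpace ℝ (Fin 3)) ≠ 0 := by
  intro h
  have h0 := congrArg (fun u : EuclideanSpace ℝ (Fin 3) => u 0) h
  simp at h0

/-- **The mirror negates the height**: `h(θ v) = -h(v)`. [folklore] -/
theorem height_thetaA (v : EuclideanSpace ℝ (Fin 3)) : thetaA v 0 + thetaA v 1 + thetaA v 2 = -(v 0 + v 1 + v 2) := by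
  rw [height_eq_inner, height_eq_inner]
  set n : EuclideanSpace ℝ (Fin 3) := EuclideanSpace.single 0 1 + EuclideanSpace.single 1 1 + EuclideanSpace.single 2 1
    with hn
  have hnn : ‖n‖ ^ 2 ≠ 0 := pow_ne_zero 2 (norm_ne_zero_iff.2 nvec_ne_zero)
  show ⟪n, (ℝ ∙ n)ᗮ.reflection v⟫_ℝ = -⟪n, v⟫_ℝ
  rw [Submodule.reflection_orthogonal_apply, Submodule.reflection_singleton_apply, inner_neg_right,
    inner_sub_right, two_smul, inner_add_right, real_inner_smul_right, real_inner_self_eq_norm_sq]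
  simp only [RCLike.ofReal_real_eq_id, id_eq]
  rw [div_mul_cancel₀ _ hnn]
  ring

/-- A point strictly below the plane is read, at every mesh `δ > 0`, at a site of `{h ≤ -1}`. [folklore] -/
theorem height_latticeApprox_le (δ : ℝ) (hδ : 0 < δ) (v : EuclideanSpace ℝ (Fin 3)) (hv : v 0 + v 1 + v 2 < 0) :
    latticeApprox δ v 0 + latticeApprox δ v 1 + latticeApprox δ v 2 ≤ -1 := by
  have h : ((latticeApprox δ v 0 + latticeApprox δ v 1 + latticeApprox δ v 2 : ℤ) : ℝ) < 0 := by
    push_cast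
    simp only [latticeApprox_apply]
    have h0 := Int.floor_le (v 0 / δ)
    have h1 := Int.floor_le (v 1 / δ)
    have h2 := Int.floor_le (v 2 / δ)
    have h3 : v 0 / δ + v 1 / δ + v 2 / δ < 0 := by
      rw [← add_div, ← add_div]
      exact div_neg_of_neg_of_pos hv hδ
    linarith
  have h' : (latticeApprox δ v 0 + latticeApprox δ v 1 + latticeApprox δ v 2 : ℤ) < 0 := by exact_mod_cast h
  omega

/-- **On the stub's set every folded site is resampled**: for `δ > 0` and `h(v) ≠ 0`, the site `[fold v/δ]` lies in
`{h ≤ -1}` (below: `h[v/δ] ≤ h(v)/δ < 0`; above: `h(θ v) = -h(v) < 0`). [folklore] -/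
theorem height_fold_site_le (δ : ℝ) (hδ : 0 < δ) (v : EuclideanSpace ℝ (Fin 3)) (hv : v 0 + v 1 + v 2 ≠ 0) :
    latticeApprox δ (foldA v) 0 + latticeApprox δ (foldA v) 1 + latticeApprox δ (foldA v) 2 ≤ -1 := by
  unfold foldA
  by_cases hle : v 0 + v 1 + v 2 ≤ 0
  · simp only [hle, if_true]
    exact height_latticeApprox_le δ hδ v (lt_of_le_of_ne hle hv)
  · simp only [hle, if_false]
    refine height_latticeApprox_le δ hδ _ ?_
    show thetaA v 0 + thetaA v 1 + thetaA v 2 < 0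
    rw [height_thetaA]
    linarith [lt_of_not_ge hle]

/-- **Exact finite-volume structure of S5b-u (everything but the limit).** For `δ > 0` and `w` off the plane:
every folded site is in `{h ≤ -1}`, the folded replica correlator is the `limsup` of the symmetric response
pairing `⟨m_old · m_new⟩^∅_{box L; β_c}`, and both responses are functions of the plane layer `σ_P` alone
(Markov). What is left is ONLY the asymptotics of this pairing (§4). [folklore] -/
theorem replicaFoldA_structure (δ : ℝ) (hδ : 0 < δ) (k : ℕ) (w : Fin k → EuclideanSpace ℝ (Fin 3))
    (hw : ∀ i, w i 0 + w i 1 + w i 2 ≠ 0) :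
    (∀ i, latticeApprox δ (foldA (w i)) 0 + latticeApprox δ (foldA (w i)) 1 + latticeApprox δ (foldA (w i)) 2 ≤ -1) ∧
    replicaFoldA δ k w = Filter.limsup (fun L : ℕ => PairIsing.gibbsAvg (nnA L) (fun s =>
        condLowA L (oldProdA L k (fun i => w i 0 + w i 1 + w i 2 ≤ 0) (fun i => latticeApprox δ (foldA (w i)))) s *
          condLowA L (newProdA L k (fun i => w i 0 + w i 1 + w i 2 ≤ 0) (fun i => latticeApprox δ (foldA (w i)))) s))
      atTop ∧
    (∀ (L : ℕ) (s₁ s₂ : SpinConfig ↥(box 3 L)), (∀ a : ↥(box 3 L), a.1 0 + a.1 1 + a.1 2 = 0 → s₁ a = s₂ a) →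
      condLowA L (oldProdA L k (fun i => w i 0 + w i 1 + w i 2 ≤ 0) (fun i => latticeApprox δ (foldA (w i)))) s₁ =
        condLowA L (oldProdA L k (fun i => w i 0 + w i 1 + w i 2 ≤ 0) (fun i => latticeApprox δ (foldA (w i)))) s₂ ∧
      condLowA L (newProdA L k (fun i => w i 0 + w i 1 + w i 2 ≤ 0) (fun i => latticeApprox δ (foldA (w i)))) s₁ =
        condLowA L (newProdA L k (fun i => w i 0 + w i 1 + w i 2 ≤ 0) (fun i => latticeApprox δ (foldA (w i)))) s₂) := by
  have hsite : ∀ i, latticeApprox δ (foldA (w i)) 0 + latticeApprox δ (foldA (w i)) 1 +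
      latticeApprox δ (foldA (w i)) 2 ≤ -1 := fun i => height_fold_site_le δ hδ (w i) (hw i)
  refine ⟨hsite, ?_, fun L s₁ s₂ hP => ⟨?_, ?_⟩⟩
  · rw [replicaFoldA_eq]
    exact limsup_congr (Eventually.of_forall fun L => replicaBoxA_eq_gibbsAvg_condLow_mul_condLow L k _ _)
  · exact condLowA_oldProdA_markov L k _ _ (fun i _ => hsite i) s₁ s₂ hP
  · exact condLowA_newProdA_markov L k _ _ (fun i _ => hsite i) s₁ s₂ hP

/-! ## §4 The open content, stated exactly, and the reduction of the registered signature to it -/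

/-- **OPEN (`responsePairing_OPEN` = S5b-u in factorised form).** For every bulk datum `(ρ, S)` and every even
`k`, the renormalised pairing of the two lower-half-crystal responses
`ρ(δ)^k · limsup_L ⟨E_L[∏_{h wᵢ ≤ 0} σ_{[wᵢ/δ]} | 𝓕] · E_L[∏_{h wᵢ > 0} σ_{[θwᵢ/δ]} | 𝓕]⟩^∅_{box L; β_c(3)}`
(`𝓕` = spins off `{h ≤ -1}`) converges to `S k` locally uniformly on the mixed admissible set. Content: asymptotic
invariance of the response pairing under the in-plane half-turn `R = -θ` (NOT a symmetry of the (111)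
half-crystal), i.e. RG-irrelevance of the `R`-odd boundary response; no proof in print. [folklore] -/
theorem responsePairing_OPEN :
    ∀ (ρ : ℝ → ℝ) (S : CorrFamily 3), (∀ δ ∈ Set.Ioc (0:ℝ) 1, 0 < ρ δ) →
      HasPointwiseScalingLimit (criticalCorr 3) ρ S → IsNondegenerateTwoPoint S → ∀ (k : ℕ), Even k →
        TendstoLocallyUniformlyOn
          (fun (δ : ℝ) (w : Fin k → EuclideanSpace ℝ (Fin 3)) => ρ δ ^ k *
            Filter.limsup (fun L : ℕ => PairIsing.gibbsAvg (nnA L) (fun s =>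
              condLowA L (oldProdA L k (fun i => w i 0 + w i 1 + w i 2 ≤ 0)
                  (fun i => latticeApprox δ (foldA (w i)))) s *
                condLowA L (newProdA L k (fun i => w i 0 + w i 1 + w i 2 ≤ 0)
                  (fun i => latticeApprox δ (foldA (w i)))) s)) atTop)
          (S k) (𝓝[>] (0:ℝ))
          (NonCoincident 3 k ∩ {w | ∀ i, w i 0 + w i 1 + w i 2 ≠ 0} ∩
            {w | (∃ i, 0 < w i 0 + w i 1 + w i 2) ∧ (∃ i, w i 0 + w i 1 + w i 2 < 0)}) := by
  sorry

/-- **OPEN, first instance (`k = 2`, one point on each side).** For `x` strictly below and `y` strictly above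
the plane, `ρ(δ)² · limsup_L ⟨m_{[x/δ]} · m_{[θy/δ]}⟩^∅_{box L; β_c(3)} → S₂(x, y)`, `m_z = E_L[σ_z | spins off {h ≤ -1}]`.
Against the bulk identity `⟨σ_{[x/δ]} σ_{[y/δ]}⟩ = ⟨m_{[x/δ]}(σ_P) · m_{-[y/δ]}(σ_P ∘ (-id))⟩` this is the
`R`-invariance of the response pairing in the limit. [folklore] -/
theorem responsePairing_two_OPEN :
    ∀ (ρ : ℝ → ℝ) (S : CorrFamily 3), (∀ δ ∈ Set.Ioc (0:ℝ) 1, 0 < ρ δ) →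
      HasPointwiseScalingLimit (criticalCorr 3) ρ S → IsNondegenerateTwoPoint S →
        ∀ (x y : EuclideanSpace ℝ (Fin 3)), x 0 + x 1 + x 2 < 0 → 0 < y 0 + y 1 + y 2 →
          Filter.Tendsto (fun δ : ℝ => ρ δ ^ 2 *
            Filter.limsup (fun L : ℕ => PairIsing.gibbsAvg (nnA L) (fun s =>
              condLowA L (fun t => if h : latticeApprox δ x ∈ box 3 L then
                  spinAt (⟨latticeApprox δ x, h⟩ : ↥(box 3 L)) t else 0) s *
                condLowA L (fun t => if h : latticeApprox δ (thetaA y) ∈ box 3 L then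
                  spinAt (⟨latticeApprox δ (thetaA y), h⟩ : ↥(box 3 L)) t else 0) s)) atTop)
            (𝓝[>] (0:ℝ)) (𝓝 (S 2 ![x, y])) := by
  sorry

/-- **Reduction (sorry-free): the registered signature of S5b-u follows from `responsePairing_OPEN`** — for every
`δ, k, w` the folded replica correlator IS the response pairing (`replicaBoxA_eq_gibbsAvg_condLow_mul_condLow`
under the `limsup`), so the two locally uniform statements have the same function. The conclusion below is the
registered signature, verbatim. [folklore] -/
theorem stub_replicaMirrorMixedUniform_of_responsePairing
    (hOPEN : ∀ (ρ : ℝ → ℝ) (S : CorrFamily 3), (∀ δ ∈ Set.Ioc (0:ℝ) 1, 0 < ρ δ) →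
      HasPointwiseScalingLimit (criticalCorr 3) ρ S → IsNondegenerateTwoPoint S → ∀ (k : ℕ), Even k →
        TendstoLocallyUniformlyOn
          (fun (δ : ℝ) (w : Fin k → EuclideanSpace ℝ (Fin 3)) => ρ δ ^ k *
            Filter.limsup (fun L : ℕ => PairIsing.gibbsAvg (nnA L) (fun s =>
              condLowA L (oldProdA L k (fun i => w i 0 + w i 1 + w i 2 ≤ 0)
                  (fun i => latticeApprox δ (foldA (w i)))) s *
                condLowA L (newProdA L k (fun i => w i 0 + w i 1 + w i 2 ≤ 0)
                  (fun i => latticeApprox δ (foldA (w i)))) s)) atTop)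
          (S k) (𝓝[>] (0:ℝ))
          (NonCoincident 3 k ∩ {w | ∀ i, w i 0 + w i 1 + w i 2 ≠ 0} ∩
            {w | (∃ i, 0 < w i 0 + w i 1 + w i 2) ∧ (∃ i, w i 0 + w i 1 + w i 2 < 0)})) :
    (fun (replicaFold : ℝ → (k : ℕ) → (Fin k → EuclideanSpace ℝ (Fin 3)) → ℝ) => ∀ (ρ : ℝ → ℝ) (S : CorrFamily 3), (∀ δ ∈ Set.Ioc (0:ℝ) 1, 0 < ρ δ) → HasPointwiseScalingLimit (criticalCorr 3) ρ S → IsNondegenerateTwoPoint S → ∀ (k : ℕ), Even k → TendstoLocallyUniformlyOn (fun (δ : ℝ) (w : Fin k → EuclideanSpace ℝ (Fin 3)) => ρ δ ^ k * replicaFold δ k w) (S k) (𝓝[>] (0:ℝ)) (NonCoincident 3 k ∩ {w | ∀ i, w i 0 + w i 1 + w i 2 ≠ 0} ∩ {w | (∃ i, 0 < w i 0 + w i 1 + w i 2) ∧ (∃ i, w i 0 + w i 1 + w i 2 < 0)})) (fun (δ : ℝ) (k : ℕ) (w : Fin k → EuclideanSpace ℝ (Fin 3)) => Filter.limsup (fun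 L : ℕ => (fun (L k : ℕ) (old : Fin k → Prop) (z : Fin k → Site 3) => PairIsing.gibbsAvg (fun a b : ↥(box 3 L) => if (∑ i, |a.1 i - b.1 i| = 1) then criticalBeta 3 / 2 else (0:ℝ)) (fun s => (∏ i, if old i then (if h : z i ∈ box 3 L then spinAt (⟨z i, h⟩ : ↥(box 3 L)) s else 0) else 1) * (fun (g : SpinConfig ↥(box 3 L) → ℝ) (s : SpinConfig ↥(box 3 L)) => (∑ s' ∈ Finset.univ.filter (fun s' : SpinConfig ↥(box 3 L) => ∀ a : ↥(box 3 L), ¬ (a.1 0 + a.1 1 + a.1 2 ≤ -1) → s' a = s a), g s' * PairIsing.gibbsWeight (fun a b : ↥(box 3 L) => if (∑ i, |a.1 i - b.1 i| = 1) then criticalBeta 3 / 2 else (0:ℝ)) s') / (∑ s' ∈ Finset.univ.filter (fun s' : SpinConfig ↥(box 3 L) => ∀ a : ↥(box 3 L), ¬ (a.1 0 + a.1 1 + a.1 2 ≤ -1) → s' a = s a), PairIsing.gibbsWeight (fun a b : ↥(box 3 L) => if (∑ i, |a.1 i - b.1 i| = 1) then criticalBeta 3 / 2 else (0:ℝ))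 s')) (fun s' => ∏ i, if old i then 1 else (if h : z i ∈ box 3 L then spinAt (⟨z i, h⟩ : ↥(box 3 L)) s' else 0)) s)) L k (fun i => w i 0 + w i 1 + w i 2 ≤ 0) (fun i => latticeApprox δ ((fun v : EuclideanSpace ℝ (Fin 3) => if v 0 + v 1 + v 2 ≤ 0 then v else (fun v : EuclideanSpace ℝ (Fin 3) => ((ℝ ∙ (EuclideanSpace.single 0 1 + EuclideanSpace.single 1 1 + EuclideanSpace.single 2 1 : EuclideanSpace ℝ (Fin 3)))ᗮ).reflection v) v) (w i)))) Filter.atTop) := by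
  intro ρ S hρ hlim hnd k hk
  -- for every `δ, w`: the response pairing IS the folded replica correlator (factorisation under the `limsup`)
  have key : ∀ (δ : ℝ) (w : Fin k → EuclideanSpace ℝ (Fin 3)),
      ρ δ ^ k * Filter.limsup (fun L : ℕ => PairIsing.gibbsAvg (nnA L) (fun s =>
          condLowA L (oldProdA L k (fun i => w i 0 + w i 1 + w i 2 ≤ 0)
              (fun i => latticeApprox δ (foldA (w i)))) s *
            condLowA L (newProdA L k (fun i => w i 0 + w i 1 + w i 2 ≤ 0)
              (fun i => latticeApprox δ (foldA (w i)))) s)) atTop =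
        ρ δ ^ k * replicaFoldA δ k w := by
    intro δ w
    rw [replicaFoldA_eq]
    exact congrArg (fun t => ρ δ ^ k * t)
      (limsup_congr (Eventually.of_forall fun L => (replicaBoxA_eq_gibbsAvg_condLow_mul_condLow L k _ _).symm))
  exact (hOPEN ρ S hρ hlim hnd k hk).congr fun δ w _ => key δ w

end Summit.CriticalPhenomena.Ising3DConformalLimit.Cruxes.TwinTransparency.ReplicaMirror.S5bAudit

end
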